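import Literature.AlgebraicGeometry.Modules.CechFullToOrderedElementwise
import Literature.AlgebraicGeometry.Modules.CechRefineAlong
import Literature.Algebra.Homology.CochainMapHomologyElementwise
import HarnessLib

/-!
# Refinement along an index map followed by restriction to increasing tuples is an isomorphism on Čech
# cohomology (The Stacks Project, Tags 01FG, 01FM, 01XD; Görtz–Wedhorn II Thm. 22.9; Hartshorne III Lemma 4.4, Thm. 4.5)

Topic `AlgebraicGeometry/Modules`; namespace `Literature.AlgebraicGeometry.Modules`.  PROOF file (theorems only: no definition,
no named fact, no instance, no notation, no `sorry`).  Cell `hodgecm-mathlib` FLOOR 0, P1 sub-line F-11, packet (iv)∕J3, letter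
**(G5-c) «the refinement map `r^*` is bijective»** (F0P1b-plan (g0) (R76); B-p01 (g17)), FILE A = the SHEAF-LEVEL half
(generalise-then-specialise: any scheme, any two covers, ANY index map).  HC_CM is proved only modulo the 7 printed citations
until rung 0 closes — nothing here bears on a summit statement.

For a scheme `X`, an `𝒪_X`-module `M`, a family of opens `𝓤 = (U_i)_{i ∈ ι}`, a finite linearly ordered family
`𝓥 = (V_j)_{j ∈ ι'}` and a map of index sets `θ : ι' → ι` with `V_j ≤ U_{θ j}` («`𝓥` refines `𝓤` along `θ`») the tree has the
sheaf-level cochain maps ★ `Cech.refineAlongChainMap M θ hV : Č•(𝓤, M) ⟶ Č•(𝓥, M)` (`Modules/CechRefineAlong`, FULL complexes)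
and ★ `CechOrd.resOfFull 𝓥 M : Č•(𝓥, M) ⟶ Č•_ord(𝓥, M)` (`Modules/CechFullToOrdered`).  Their composite
`Ψ := refineAlong ≫ res : Č•(𝓤, M) ⟶ Č•_ord(𝓥, M)` covers `𝟙_M` (★ `Cech.augment_refineAlong`, ★ `CechOrd.augment_resOfFullObj`),
so when both complexes are `Ext(𝒪_X, –)`-acyclic exact resolutions (affine faces, `M` affine-localizing) the naturality of the
Leray isomorphisms (★ `AcyclicResolution.extAddEquivHomologySucc_naturality`) gives:

* §1 `CechOrd.homTopAddEquiv_refineRes` — on cochains `Hom(𝒪_X, Ψ)` is `res ∘ refineAlong`;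
* §2 **`CechOrd.homologyMap_refineRes_extUnitAddEquivHomologySucc`** — the Leray square `H(Γ(X, Ψ)) ∘ Leray_full,𝓤 = Leray_ord,𝓥`,
  whence **`CechOrd.homologyMap_refineRes_bijective`** (and the degree-`0` twins, any covers): `Hⁿ(Γ(X, Ψ))` is BIJECTIVE —
  the cohomological content of «Čech cohomology of a quasi-coherent sheaf does not depend on the affine cover»
  ([StacksProject, Tag 01XD]; [Hartshorne1977, III Thm. 4.5]) in the form «the refinement map is an isomorphism»;
* §3 the same ELEMENTWISE (★ `Algebra/Homology/CochainMapHomologyElementwise`): `CechOrd.exists_dSections_eq_of_refineRes_eq_d`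
  (a full cocycle on `𝓤` whose refined-and-restricted cochain is an ordered coboundary on `𝓥` is a full coboundary) and
  `CechOrd.exists_refineRes_eq_add_d` (every ordered cocycle on `𝓥` is, up to an ordered coboundary, the refined-and-restricted
  cochain of a full cocycle on `𝓤`), in positive degrees and in degree `0`.

FILE B (`Modules/CechOrderedRefinementComparison`) transports §3 through the cochain dictionaries ★ D20
`Modules/CechSectionsCochainDictionary` to the ORDERED module Čech complexes ★ `Modules.cechComplex` and the refinement
★ `OrderedCech.refineCochain θ φ` of `Algebra/Homology/OrderedCechSystemAlternating`.

## References
* The Stacks Project, Tag 01FG (Čech complexes and refinement), Tag 01FM (alternating∕ordered complex), Tag 01XD (Čech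
  cohomology of quasi-coherent modules on affine covers). [StacksProject]
* U. Görtz, T. Wedhorn, *Algebraic Geometry II* (2023), Def. 21.64, Def. 21.68, Thm. 22.9 (p. 236). [GortzWedhorn2023]
* R. Hartshorne, *Algebraic Geometry*, GTM 52 (1977), III Lemma 4.4, Thm. 4.5 (pp. 220–222). [Hartshorne1977]
-/

noncomputable section

universe w u

open CategoryTheory CategoryTheory.Abelian CategoryTheory.Limits Opposite TopologicalSpace AlgebraicGeometry
open Literature.Algebra.Homology

namespace Literature.AlgebraicGeometry.Modules

namespace CechOrd

variable {X : Scheme.{u}} {ι ι' : Type u} [LinearOrder ι'] [Fintype ι'] (U : ι → X.Opens) (V : ι' → X.Opens)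
  (M : X.Modules) (θ : ι' → ι) (hV : ∀ j, V j ≤ U (θ j))
variable [HasExt.{w} X.Modules]

/-! ## §1 The composite `Ψ = refineAlong ≫ res` on cochains and on augmentations -/

/-- **`Hom(𝒪_X, Ψ)` on cochains is `res ∘ refineAlong`**: under the dictionaries `Ext⁰(𝒪_X, Čⁿ(𝓤, M)) ≃+ Π_α Γ(M, X ∩ U_α)` and
`Ext⁰(𝒪_X, Čⁿ_ord(𝓥, M)) ≃+ Π_s Γ(M, X ∩ V_s)` the degree-`n` component of `Hom(𝒪_X, refineAlong ≫ res)` sends `c` to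
`s ↦ c_{θ ∘ e_s}|`. [cite: StacksProject, Tag 01FG] -/
theorem homTopAddEquiv_refineRes (n : ℕ) (x : Ext.{w} (unitModule X) ((Cech.complex U M).X n) 0) :
    homTopAddEquiv V M n (((AcyclicResolution.extComplexMap (unitModule X)
        (Cech.refineAlongChainMap M θ hV ≫ resOfFull V M)).f n).hom x) =
      ((resOfFullObj V M n).app ⊤ ((Cech.refineAlong M θ hV n).app ⊤ (Cech.homTopAddEquiv U M n x)) :
        Cech.Sections (faces V n) 0 M ⊤) := by
  obtain ⟨f, rfl⟩ : ∃ f : unitModule X ⟶ (Cech.complex U M).X n, Ext.mk₀ f = x :=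
    ⟨Ext.homEquiv₀ x, Ext.mk₀_homEquiv₀_apply x⟩
  rw [AcyclicResolution.extComplexMap_f_apply, Ext.mk₀_comp_mk₀, homTopAddEquiv_mk₀, Cech.homTopAddEquiv_mk₀,
    HomologicalComplex.comp_f, Cech.refineAlongChainMap_f, resOfFull_f, Scheme.Modules.Hom.comp_app,
    Scheme.Modules.Hom.comp_app, CategoryTheory.comp_apply, CategoryTheory.comp_apply]
  rfl

omit [HasExt.{w} X.Modules] in
/-- **`Ψ = refineAlong ≫ res` covers the identity of `M`**: `ε_𝓤 ≫ Ψ⁰ = 𝟙_M ≫ ε_ord,𝓥` for the canonical exact augmentations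
of the full Čech resolution on `𝓤` and the ordered one on `𝓥`. [cite: StacksProject, Tag 01FG] -/
theorem exactAugmentation_ε_refineRes (hUcov : ⨆ i, U i = ⊤) (hVcov : ⨆ j, V j = ⊤) :
    (Cech.exactAugmentation U M hUcov).ε ≫ (Cech.refineAlongChainMap M θ hV ≫ resOfFull V M).f 0 =
      𝟙 M ≫ (exactAugmentation V M hVcov).ε := by
  rw [Category.id_comp, HomologicalComplex.comp_f, ← Category.assoc]
  have h1 : (Cech.exactAugmentation U M hUcov).ε ≫ (Cech.refineAlongChainMap M θ hV).f 0 =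
      (Cech.exactAugmentation V M hVcov).ε := Cech.augment_refineAlong M θ hV
  rw [h1]
  exact augment_resOfFullObj V M

/-! ## §2 The Leray square for `Ψ`: `H(Γ(X, Ψ))` is an isomorphism -/

/-- **The Leray square for `Ψ = refineAlong ≫ res`**: `Hⁿ⁺¹(Γ(X, Ψ)) ∘ Leray_full,𝓤 = Leray_ord,𝓥` on `Extⁿ⁺¹(𝒪_X, M)` —
★ `AcyclicResolution.extAddEquivHomologySucc_naturality` for the morphism `(𝟙_M, Ψ)` of exact `Ext(𝒪_X, –)`-acyclic augmented
complexes (the full Čech resolution on `𝓤` with affine faces, the ordered one on `𝓥` with affine finite intersections, `M`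
affine-localizing). [cite: StacksProject, Tag 01XD] [cite: GortzWedhorn2023, Thm. 22.9 (p. 236)] [cite: Hartshorne1977, III Lemma 4.4, Thm. 4.5] -/
theorem homologyMap_refineRes_extUnitAddEquivHomologySucc
    (hU : ∀ {m : ℕ} (β : Fin (m + 1) → ι), IsAffineOpen (face U β))
    (hV' : ∀ s : Finset ι', s.Nonempty → IsAffineOpen (faceSet V s))
    (hUcov : ⨆ i, U i = ⊤) (hVcov : ⨆ j, V j = ⊤) (hM : IsAffineLocalizing M) (n : ℕ)
    (x : Ext.{w} (unitModule X) M (n + 1)) :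
    (HomologicalComplex.homologyMap (AcyclicResolution.extComplexMap (unitModule X)
        (Cech.refineAlongChainMap M θ hV ≫ resOfFull V M)) (n + 1)).hom
        (Cech.extUnitAddEquivHomologySucc U M hU hUcov hM n x) =
      extUnitAddEquivHomologySucc V M hV' hVcov hM n x := by
  haveI := (Cech.exactAugmentation U M hUcov).mono_ε
  haveI := (exactAugmentation V M hVcov).mono_ε
  have hg := exactAugmentation_ε_refineRes U V M θ hV hUcov hVcov
  have h := AcyclicResolution.extAddEquivHomologySucc_naturality (unitModule X)
    (Cech.refineAlongChainMap M θ hV ≫ resOfFull V M)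
    (Cech.exactAugmentation U M hUcov).ε (Cech.exactAugmentation U M hUcov).ε_d (Cech.exactAugmentation U M hUcov).exact₀
    (exactAugmentation V M hVcov).ε (exactAugmentation V M hVcov).ε_d (exactAugmentation V M hVcov).exact₀
    (𝟙 M) hg (Cech.exactAugmentation U M hUcov).exactAt_succ
    (fun k q e => (Cech.subsingleton_ext_unit_obj_of_isAffineLocalizing.{w} U k hU hUcov hM q).elim e 0)
    (exactAugmentation V M hVcov).exactAt_succ
    (fun k q e => (subsingleton_ext_unit_complex_X V M hV' hVcov hM k q).elim e 0) n x
  rw [Ext.comp_mk₀_id] at h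
  exact h

/-- **`Hⁿ⁺¹(Γ(X, Ψ)) : Hⁿ⁺¹(Γ(X, Č•(𝓤, M))) → Hⁿ⁺¹(Γ(X, Č•_ord(𝓥, M)))` is BIJECTIVE** (`= Leray_ord,𝓥 ∘ Leray_full,𝓤⁻¹`) for
`𝓤` a cover with affine faces, `𝓥` a finite cover with affine finite intersections refining `𝓤` along ANY index map `θ`, and `M`
affine-localizing: Čech cohomology of a quasi-coherent module on affine covers does not depend on the cover, the comparison
being the refinement map. [cite: StacksProject, Tag 01XD] [cite: GortzWedhorn2023, Thm. 22.9 (p. 236)] [cite: Hartshorne1977, III Thm. 4.5] -/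
theorem homologyMap_refineRes_bijective
    (hU : ∀ {m : ℕ} (β : Fin (m + 1) → ι), IsAffineOpen (face U β))
    (hV' : ∀ s : Finset ι', s.Nonempty → IsAffineOpen (faceSet V s))
    (hUcov : ⨆ i, U i = ⊤) (hVcov : ⨆ j, V j = ⊤) (hM : IsAffineLocalizing M) (n : ℕ) :
    Function.Bijective
      (HomologicalComplex.homologyMap (AcyclicResolution.extComplexMap (unitModule X)
        (Cech.refineAlongChainMap M θ hV ≫ resOfFull V M)) (n + 1)).hom := by
  have hfac : ⇑(HomologicalComplex.homologyMap (AcyclicResolution.extComplexMap (unitModule X)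
      (Cech.refineAlongChainMap M θ hV ≫ resOfFull V M)) (n + 1)).hom =
        ⇑(extUnitAddEquivHomologySucc V M hV' hVcov hM n) ∘ ⇑(Cech.extUnitAddEquivHomologySucc U M hU hUcov hM n).symm := by
    funext y
    simp only [Function.comp_apply]
    rw [← homologyMap_refineRes_extUnitAddEquivHomologySucc U V M θ hV hU hV' hUcov hVcov hM n,
      AddEquiv.apply_symm_apply]
  rw [hfac]
  exact (extUnitAddEquivHomologySucc V M hV' hVcov hM n).bijective.comp
    (Cech.extUnitAddEquivHomologySucc U M hU hUcov hM n).symm.bijective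

/-- **Degree `0`**: `H⁰(Γ(X, Ψ)) ∘ Leray_full,𝓤 = Leray_ord,𝓥` on `Ext⁰(𝒪_X, M) = Γ(X, M)` (any covers `𝓤`, `𝓥`).
[cite: StacksProject, Tag 01FG] [cite: Hartshorne1977, III Lemma 4.4] -/
theorem homologyMap_refineRes_extUnitAddEquivHomologyZero (hUcov : ⨆ i, U i = ⊤) (hVcov : ⨆ j, V j = ⊤)
    (x : Ext.{w} (unitModule X) M 0) :
    (HomologicalComplex.homologyMap (AcyclicResolution.extComplexMap (unitModule X)
        (Cech.refineAlongChainMap M θ hV ≫ resOfFull V M)) 0).hom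
        (Cech.extUnitAddEquivHomologyZero U M hUcov x) =
      extUnitAddEquivHomologyZero V M hVcov x := by
  haveI := (Cech.exactAugmentation U M hUcov).mono_ε
  haveI := (exactAugmentation V M hVcov).mono_ε
  have hg := exactAugmentation_ε_refineRes U V M θ hV hUcov hVcov
  have h := AcyclicResolution.extAddEquivHomologyZero_naturality (unitModule X)
    (Cech.refineAlongChainMap M θ hV ≫ resOfFull V M)
    (Cech.exactAugmentation U M hUcov).ε (Cech.exactAugmentation U M hUcov).ε_d (Cech.exactAugmentation U M hUcov).exact₀
    (exactAugmentation V M hVcov).ε (exactAugmentation V M hVcov).ε_d (exactAugmentation V M hVcov).exact₀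
    (𝟙 M) hg x
  rw [Ext.comp_mk₀_id] at h
  exact h

/-- **Degree `0`**: `H⁰(Γ(X, Ψ))` is bijective for every cover `𝓤` and finite cover `𝓥` refining it (both sides are `Γ(X, M)`).
[cite: StacksProject, Tag 01FG] [cite: Hartshorne1977, III Lemma 4.4] -/
theorem homologyMap_refineRes_bijective_zero (hUcov : ⨆ i, U i = ⊤) (hVcov : ⨆ j, V j = ⊤) :
    Function.Bijective
      (HomologicalComplex.homologyMap (AcyclicResolution.extComplexMap (unitModule X)
        (Cech.refineAlongChainMap M θ hV ≫ resOfFull V M)) 0).hom := by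
  have hfac : ⇑(HomologicalComplex.homologyMap (AcyclicResolution.extComplexMap (unitModule X)
      (Cech.refineAlongChainMap M θ hV ≫ resOfFull V M)) 0).hom =
        ⇑(extUnitAddEquivHomologyZero V M hVcov) ∘ ⇑(Cech.extUnitAddEquivHomologyZero U M hUcov).symm := by
    funext y
    simp only [Function.comp_apply]
    rw [← homologyMap_refineRes_extUnitAddEquivHomologyZero U V M θ hV hUcov hVcov, AddEquiv.apply_symm_apply]
  rw [hfac]
  exact (extUnitAddEquivHomologyZero V M hVcov).bijective.comp (Cech.extUnitAddEquivHomologyZero U M hUcov).symm.bijective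

/-! ## §3 The same, elementwise on cochains -/

/-- **Injectivity, elementwise, positive degree**: for `𝓤` with affine faces, `𝓥` finite with affine finite intersections
refining `𝓤` along `θ`, both covers, `M` affine-localizing — a full Čech `(n+1)`-cocycle `c ∈ Π_α Γ(M, U_α)` whose
refined-and-restricted cochain `(c_{θ ∘ e_s}|)_s` is an ordered coboundary `d g` on `𝓥` is a full coboundary `c = d w` on `𝓤`.
[cite: StacksProject, Tag 01XD] [cite: StacksProject, Tag 01FG] [cite: Hartshorne1977, III Lemma 4.4, Thm. 4.5] -/
theorem exists_dSections_eq_of_refineRes_eq_d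
    (hU : ∀ {m : ℕ} (β : Fin (m + 1) → ι), IsAffineOpen (face U β))
    (hV' : ∀ s : Finset ι', s.Nonempty → IsAffineOpen (faceSet V s))
    (hUcov : ⨆ i, U i = ⊤) (hVcov : ⨆ j, V j = ⊤) (hM : IsAffineLocalizing M) (n : ℕ)
    (c : Cech.Sections U (n + 1) M ⊤) (hc : Cech.dSections U M (n + 1) ⊤ c = 0)
    (g : Cech.Sections (faces V n) 0 M ⊤)
    (hg : ((resOfFullObj V M (n + 1)).app ⊤ ((Cech.refineAlong M θ hV (n + 1)).app ⊤ c) :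
      Cech.Sections (faces V (n + 1)) 0 M ⊤) = (d V M n).app ⊤ g) :
    ∃ w : Cech.Sections U n M ⊤, Cech.dSections U M n ⊤ w = c := by
  set K := Cech.homComplex.{w} U M with hK
  set K' := homComplex.{w} V M with hK'
  set ψ : K ⟶ K' := AcyclicResolution.extComplexMap (unitModule X)
    (Cech.refineAlongChainMap M θ hV ≫ resOfFull V M) with hψ
  -- the cochains as elements of `K`, `K'`
  set x : K.X (n + 1) := (Cech.homTopAddEquiv U M (n + 1)).symm c with hx
  set y : K'.X n := (homTopAddEquiv V M n).symm g with hy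
  have hxc : Cech.homTopAddEquiv U M (n + 1) x = c := AddEquiv.apply_symm_apply _ c
  have hyg : homTopAddEquiv V M n y = g := AddEquiv.apply_symm_apply _ g
  have hdx : (K.d (n + 1) (n + 2)).hom x = 0 := by
    apply (Cech.homTopAddEquiv U M (n + 2)).injective
    rw [Cech.homTopAddEquiv_d, hxc, hc]
    exact ((Cech.homTopAddEquiv U M (n + 2)).map_zero).symm
  have hψx : (ψ.f (n + 1)).hom x = (K'.d n (n + 1)).hom y := by
    apply (homTopAddEquiv V M (n + 1)).injective
    rw [homTopAddEquiv_refineRes, hxc, hg, homTopAddEquiv_d, hyg]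
  obtain ⟨w, hw⟩ := HomologyElementwise.exists_d_eq_of_homologyMap_injective ψ n (n + 1) (n + 2)
    (CochainComplex.prev_nat_succ n) (CochainComplex.next ℕ (n + 1))
    (homologyMap_refineRes_bijective.{w} U V M θ hV hU hV' hUcov hVcov hM n).1 x hdx y hψx
  refine ⟨Cech.homTopAddEquiv U M n w, ?_⟩
  rw [← Cech.homTopAddEquiv_d, hw, hxc]

/-- **Surjectivity, elementwise, positive degree**: under the same hypotheses every ordered `(n+1)`-cocycle `g'` on `𝓥` is,
up to an ordered coboundary `d h`, the refined-and-restricted cochain of a full `(n+1)`-cocycle `c` on `𝓤`: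
`(c_{θ ∘ e_s}|)_s = g' + d h`. [cite: StacksProject, Tag 01XD] [cite: StacksProject, Tag 01FG] [cite: Hartshorne1977, III Lemma 4.4, Thm. 4.5] -/
theorem exists_refineRes_eq_add_d
    (hU : ∀ {m : ℕ} (β : Fin (m + 1) → ι), IsAffineOpen (face U β))
    (hV' : ∀ s : Finset ι', s.Nonempty → IsAffineOpen (faceSet V s))
    (hUcov : ⨆ i, U i = ⊤) (hVcov : ⨆ j, V j = ⊤) (hM : IsAffineLocalizing M) (n : ℕ)
    (g' : Γ(obj V M (n + 1), ⊤)) (hg' : (d V M (n + 1)).app ⊤ g' = 0) :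
    ∃ (c : Cech.Sections U (n + 1) M ⊤) (h : Cech.Sections (faces V n) 0 M ⊤),
      Cech.dSections U M (n + 1) ⊤ c = 0 ∧
      (resOfFullObj V M (n + 1)).app ⊤ ((Cech.refineAlong M θ hV (n + 1)).app ⊤ c) = g' + (d V M n).app ⊤ h := by
  set K := Cech.homComplex.{w} U M with hK
  set K' := homComplex.{w} V M with hK'
  set ψ : K ⟶ K' := AcyclicResolution.extComplexMap (unitModule X)
    (Cech.refineAlongChainMap M θ hV ≫ resOfFull V M) with hψ
  set x' : K'.X (n + 1) := (homTopAddEquiv V M (n + 1)).symm g' with hx'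
  have hx'g : homTopAddEquiv V M (n + 1) x' = g' := AddEquiv.apply_symm_apply _ g'
  have hdx' : (K'.d (n + 1) (n + 2)).hom x' = 0 := by
    apply (homTopAddEquiv V M (n + 2)).injective
    rw [homTopAddEquiv_d, hx'g, hg']
    exact ((homTopAddEquiv V M (n + 2)).map_zero).symm
  obtain ⟨x, y, hdx, hxy⟩ := HomologyElementwise.exists_eq_add_d_of_homologyMap_surjective ψ n (n + 1) (n + 2)
    (CochainComplex.prev_nat_succ n) (CochainComplex.next ℕ (n + 1))
    (homologyMap_refineRes_bijective.{w} U V M θ hV hU hV' hUcov hVcov hM n).2 x' hdx'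
  refine ⟨Cech.homTopAddEquiv U M (n + 1) x, homTopAddEquiv V M n y, ?_, ?_⟩
  · rw [← Cech.homTopAddEquiv_d, hdx]
    exact (Cech.homTopAddEquiv U M (n + 2)).map_zero
  · have hadd : homTopAddEquiv V M (n + 1) (x' + (K'.d n (n + 1)).hom y) =
        homTopAddEquiv V M (n + 1) x' + homTopAddEquiv V M (n + 1) ((K'.d n (n + 1)).hom y) :=
      map_add (homTopAddEquiv V M (n + 1)) _ _
    rw [← homTopAddEquiv_refineRes, hxy, hadd, hx'g, homTopAddEquiv_d]
    rfl

/-- **Injectivity, elementwise, degree `0`** (any covers): a full `0`-cocycle `c` on `𝓤` whose refined-and-restricted cochain on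
`𝓥` vanishes is `0` (both are the restrictions of one global section). [cite: StacksProject, Tag 01FG] [cite: Hartshorne1977, III Lemma 4.4] -/
theorem eq_zero_of_refineRes_eq_zero (hUcov : ⨆ i, U i = ⊤) (hVcov : ⨆ j, V j = ⊤)
    (c : Cech.Sections U 0 M ⊤) (hc : Cech.dSections U M 0 ⊤ c = 0)
    (h0 : ((resOfFullObj V M 0).app ⊤ ((Cech.refineAlong M θ hV 0).app ⊤ c) : Cech.Sections (faces V 0) 0 M ⊤) = 0) :
    c = 0 := by
  set K := Cech.homComplex.{w} U M with hK
  set K' := homComplex.{w} V M with hK'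
  set ψ : K ⟶ K' := AcyclicResolution.extComplexMap (unitModule X)
    (Cech.refineAlongChainMap M θ hV ≫ resOfFull V M) with hψ
  set x : K.X 0 := (Cech.homTopAddEquiv U M 0).symm c with hx
  have hxc : Cech.homTopAddEquiv U M 0 x = c := AddEquiv.apply_symm_apply _ c
  have hdx : (K.d 0 1).hom x = 0 := by
    apply (Cech.homTopAddEquiv U M 1).injective
    rw [Cech.homTopAddEquiv_d, hxc, hc]
    exact ((Cech.homTopAddEquiv U M 1).map_zero).symm
  have hψx : (ψ.f 0).hom x = (K'.d 0 0).hom 0 := by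
    apply (homTopAddEquiv V M 0).injective
    rw [map_zero, homTopAddEquiv_refineRes, hxc, h0]
    exact ((homTopAddEquiv V M 0).map_zero).symm
  obtain ⟨w, hw⟩ := HomologyElementwise.exists_d_eq_of_homologyMap_injective ψ 0 0 1
    CochainComplex.prev_nat_zero (CochainComplex.next ℕ 0)
    (homologyMap_refineRes_bijective_zero.{w} U V M θ hV hUcov hVcov).1 x hdx 0 hψx
  rw [K.shape 0 0 (by simp), AddCommGrpCat.hom_zero, AddMonoidHom.zero_apply] at hw
  rw [← hxc, ← hw]
  exact (Cech.homTopAddEquiv U M 0).map_zero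

/-- **Surjectivity, elementwise, degree `0`** (any covers): every ordered `0`-cocycle `g'` on `𝓥` is the refined-and-restricted
cochain of a full `0`-cocycle `c` on `𝓤` (both are families of restrictions of one global section).
[cite: StacksProject, Tag 01FG] [cite: Hartshorne1977, III Lemma 4.4] -/
theorem exists_refineRes_eq_zero (hUcov : ⨆ i, U i = ⊤) (hVcov : ⨆ j, V j = ⊤)
    (g' : Γ(obj V M 0, ⊤)) (hg' : (d V M 0).app ⊤ g' = 0) :
    ∃ c : Cech.Sections U 0 M ⊤, Cech.dSections U M 0 ⊤ c = 0 ∧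
      (resOfFullObj V M 0).app ⊤ ((Cech.refineAlong M θ hV 0).app ⊤ c) = g' := by
  set K := Cech.homComplex.{w} U M with hK
  set K' := homComplex.{w} V M with hK'
  set ψ : K ⟶ K' := AcyclicResolution.extComplexMap (unitModule X)
    (Cech.refineAlongChainMap M θ hV ≫ resOfFull V M) with hψ
  set x' : K'.X 0 := (homTopAddEquiv V M 0).symm g' with hx'
  have hx'g : homTopAddEquiv V M 0 x' = g' := AddEquiv.apply_symm_apply _ g'
  have hdx' : (K'.d 0 1).hom x' = 0 := by
    apply (homTopAddEquiv V M 1).injective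
    rw [homTopAddEquiv_d, hx'g, hg']
    exact ((homTopAddEquiv V M 1).map_zero).symm
  obtain ⟨x, y, hdx, hxy⟩ := HomologyElementwise.exists_eq_add_d_of_homologyMap_surjective ψ 0 0 1
    CochainComplex.prev_nat_zero (CochainComplex.next ℕ 0)
    (homologyMap_refineRes_bijective_zero.{w} U V M θ hV hUcov hVcov).2 x' hdx'
  rw [K'.shape 0 0 (by simp), AddCommGrpCat.hom_zero, AddMonoidHom.zero_apply, add_zero] at hxy
  refine ⟨Cech.homTopAddEquiv U M 0 x, ?_, ?_⟩
  · rw [← Cech.homTopAddEquiv_d, hdx]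
    exact (Cech.homTopAddEquiv U M 1).map_zero
  · rw [← homTopAddEquiv_refineRes, hxy, hx'g]

end CechOrd

end Literature.AlgebraicGeometry.Modules

end
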